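import Summits.QuantumFields.YangMills.Theorems.UnitScaleTiltProp7FrameMassStep
import Literature.MathematicalPhysics.QuantumFieldTheory.Balaban1983to89.B7Eq99Concrete
import HarnessLib

/-!
# Route `UnitScaleTilt`, crux K1 «MinimiserStabilityRegPr» (stmt-QuantumFields-19200), route-R E′ (A′)-on-Σ, P-A2-COMB (β), item «F3″-COMB» (★★OWNER RULING №19), file F1 —
# THE ONE-STEP INEQUALITY FOR PRINT's COMB ACCUMULATED FRAMES `v_j = vcov` ((97) of [Balaban1985Averaging]), POINTWISE:
# `‖v_{j+1}(z) − 1‖ ≤ (Lᵈ)⁻¹·Σ_r (‖R_r(z) − 1‖ + ‖a_r(z) − 1‖) + 6t²` — the centre frame cancels at first order, exactly as for the symmetric frames (✓ `Prop7AccumulatedFrameStep`)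

Cell `ym3-torus`, extra width seat `ym-routeR-w6` (gen 8); LOCATE `LOCATE-F3COMB-routeRw6g8.md` (19200 evidence #54); ★★OWNER RULING №19 (05:13Z) «F3″-COMB (c1)(c2)(c4) under `hMcomb` :=
routeR-w6 — GO».  THEOREMS ONLY (0 `def`, 0 `sorry`); `--supports stmt-QuantumFields-19200 --as helper`, count-neutral.  YM₃ on T³ is a ladder rung (R3), not the Clay problem; nothing
here claims the stub, the crux, (β), `hPA2`, `hcoS`, d = 4 or the mass gap.

THE POINT (LOCATE #54 §1).  The comb accumulated frame of the route's twisted chart, `frameTw F n K h U₀ A y = wrec … (K − n) (coordT3 y)` (✓ `Prop7SymAvgTwDefs`), is print's block average (85),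
and by (99) `wrec = vcov` (lit ✓ `B7Eq99Concrete.wrec_eq_vcov`) it obeys the accumulation (97) `v_{j+1}(z) = v_j(L•z)·w(Ū₀ʲ, U̿₁ʲ)(L•z)` (lit ✓ `B7Eq92Concrete.vcov_succ`) with the one-step comb
frame (82) `w(V₀, V₁)(y) = exp[Σ_{r} L^{−d} log (R_{0,y}V₁)(Γ_{y,y+r})]` (lit `wframe`∕`Fcov`) over the CORNERED box and the tree contours.  By the fundamental equality (92)∕(97)
`Ũ₁ʲ = (U̿₁ʲ)^{v_j}` (lit ✓ `tildIter_eq_mgauge`) and the transporter covariance (60) (lit ✓ `tHol_mgauge`), the twisted tree transport of the double-bar tower factors EXACTLY as in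
✓px22 `Prop7AccumulatedFrameStep.tstairU_eq_frame_inv_mul`: `(R_{0,y}U̿₁ʲ)(Γ) = v_j(y)⁻¹ · (R_{0,y}Ũ₁ʲ)(Γ) · R(Ū₀ʲ(Γ))v_j(y + disp Γ)` — centre frame⁻¹ × SINGLE-BAR TREE RATIO of
PRINT's comb tower ((58)∕(69): `(R_{0,y}Ũ₁ʲ)(Γ) = (U₁U₀)‾ʲ(Γ)·Ū₀ʲ(Γ)⁻¹`) × the rotated frame at the contour's end.  Since the one-step frame IS `ExpMeanLog.eml` over the offsets
`Fin d → Fin L` (§1), ✓px22's ABSTRACT inequality `norm_mul_eml_sub_one_le_split` (imported, not retyped) gives the title row (§2): the `hΦ`-step of the comb frame-mass recursion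
(file F2) whose source is the single-bar tree-ratio mass of print's comb tower — the displayed route-internal row `hMcomb` of RULING №19 («(n3)-comb», OPEN, XL, LOCATE #54; NOT N06,
NOT a print row), consumed in file F3.

WHAT IS PROVED (ns `…Theorems.Prop7CombAccFrameStep`; generic `ℤᵈ` lattice `B7Prop1Explicit.Site d`, complete normed ℂ-algebra `𝔸`, any `L`, any unit-valued `U₀ U₁`):
* §1 `coe_wframe_eq_eml` — `↑(wframe L V₀ V₁ y) = eml (r ↦ ↑((R_{0,y}V₁)(Γ_r)))` ((82) is (0.4)'s `exp[mean log]` over the offsets);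
  ★ `tHol_dbavgCovIter_eq_frame_inv_mul` — the factorisation above ((92)∕(97) + (60)).
* §2 ★★ `norm_vcov_succ_sub_one_le` — `‖↑(v_{j+1}(z)) − 1‖ ≤ (Lᵈ)⁻¹·Σ_r (‖↑(R_r) − 1‖ + ‖↑(a_r) − 1‖) + 6t²` under `‖v_j(L•z)‖ ≤ 1`, `‖a_r‖ ≤ 1`, `‖(R_{0,L•z}U̿₁ʲ)(Γ_r) − 1‖ ≤ t ≤ ¼`;
  ★★ `norm_vcov_succ_sub_one_le_of_bicontractive` — the same with `‖a_r − 1‖ ≤ ‖v_j(L•z + r) − 1‖` and `‖a_r‖ ≤ 1` DISCHARGED from bi-contractivity of the background tree transports and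
  of the frames (✓px22 `Prop7FrameMassStep.norm_conj_sub_one_le`∕`norm_conj_le_one`) — the shape file F2 sums in `ℓ²`.
HONEST SCOPE.  Algebra + one imported abstract inequality; no smallness is produced here (the sup∕unitarity rows come from lit `B8Prop7AdmittedFamily` in file F3); nothing of print asserted
beyond its own identities already certified in lit; no summit statement is advanced.

References: T. Bałaban, CMP 98 (1985) 17–51 [Balaban1985Averaging] ((26)–(27) p.22, (58)–(60) p.27, (69) p.29, (82) p.30, (85)–(92) p.31, (97)–(99) p.32); CMP 109 (1987) 249–301
[Balaban1987RG1] ((0.4) p.253).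
-/

set_option autoImplicit false

noncomputable section

open scoped BigOperators

namespace Summit.QuantumFields.YangMills.Theorems.Prop7CombAccFrameStep

open NormedSpace
open Literature.MathematicalPhysics.QuantumFieldTheory.Balaban1983to89
open ExpMeanLog (eml eml_eq_exp_sum)
open B7Prop1Explicit (Site hol disp treeWord disp_treeWord boxVec expUnit val_expUnit)
open B7Prop2Explicit (avgIter)
open B7Eq92Concrete (Rc Rc_apply mgauge tHol tHol_mgauge Fcov wframe dbavgCovIter tildIter vcov vcov_succ tildIter_eq_mgauge)
open Summit.QuantumFields.YangMills.Theorems.Prop7AccumulatedFrameStep (norm_mul_eml_sub_one_le_split)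
open Summit.QuantumFields.YangMills.Theorems.Prop7FrameMassStep (norm_conj_sub_one_le norm_conj_le_one)

variable {d : ℕ} {𝔸 : Type*} [NormedRing 𝔸] [NormedAlgebra ℂ 𝔸] [CompleteSpace 𝔸]

/-! ## §1 The one-step comb frame is `exp[mean log]`; the twisted tree transport of the double-bar tower factors through the single-bar tree ratio -/

/-- **(82) IS (0.4)'s `exp[mean log]` OVER THE OFFSETS**: `↑(\overline{R_{0,y}V₁}) = eml (r ↦ ↑((R_{0,y}V₁)(Γ_{y,y+r})))`, the weights `L^{−d} = |Fin d → Fin L|⁻¹`.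
[cite: Balaban1985Averaging, (82) p.30, (78) p.30; Balaban1987RG1, (0.4) p.253] -/
theorem coe_wframe_eq_eml (L : ℕ) (V₀ V₁ : Site d → Fin d → 𝔸ˣ) (y : Site d) :
    ((wframe L V₀ V₁ y : 𝔸ˣ) : 𝔸) = eml (fun r : Fin d → Fin L => ((tHol V₀ V₁ y (treeWord (boxVec L r)) : 𝔸ˣ) : 𝔸)) := by
  rw [wframe, val_expUnit, eml_eq_exp_sum, Fcov]
  congr 1
  refine Finset.sum_congr rfl fun r _ => ?_
  rw [Fintype.card_fun, Fintype.card_fin, Fintype.card_fin, Nat.cast_pow]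

/-- ★ **THE TWISTED TREE TRANSPORT OF THE DOUBLE-BAR TOWER THROUGH THE SINGLE-BAR COMB TOWER** ((92)∕(97) `Ũ₁ʲ = (U̿₁ʲ)^{v_j}` + (60)):
`(R_{0,y}U̿₁ʲ)(Γ) = v_j(y)⁻¹ · (R_{0,y}Ũ₁ʲ)(Γ) · R(Ū₀ʲ(Γ)) v_j(y + disp Γ)` for every contour `Γ` from `y` — centre frame⁻¹ × single-bar tree ratio × rotated end frame.
[cite: Balaban1985Averaging, (92) p.31, (97) p.32, (58)-(60) p.27] -/
theorem tHol_dbavgCovIter_eq_frame_inv_mul (L : ℕ) (U₀ U₁ : Site d → Fin d → 𝔸ˣ) (j : ℕ) (y : Site d) (w : List (B7Prop1Explicit.Letter d)) :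
    tHol (avgIter L U₀ j) (dbavgCovIter L U₀ U₁ j) y w
      = (vcov L U₀ U₁ j y)⁻¹ * (tHol (avgIter L U₀ j) (tildIter L U₀ U₁ j) y w * Rc (hol (avgIter L U₀ j) y w) (vcov L U₀ U₁ j (y + disp w))) := by
  have h : tHol (avgIter L U₀ j) (tildIter L U₀ U₁ j) y w
      = vcov L U₀ U₁ j y * tHol (avgIter L U₀ j) (dbavgCovIter L U₀ U₁ j) y w * (Rc (hol (avgIter L U₀ j) y w) (vcov L U₀ U₁ j (y + disp w)))⁻¹ := by
    rw [tildIter_eq_mgauge L U₀ U₁ j, tHol_mgauge]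
  rw [h]
  group

/-- (97) read with §1: `↑(v_{j+1}(z)) = ↑(v_j(L•z)) · eml (r ↦ ↑(v_j(L•z))⁻¹ · (↑(R_r) · ↑(a_r)))` with the single-bar tree ratio `R_r = (R_{0,L•z}Ũ₁ʲ)(Γ_r)` and the rotated end frame
`a_r = R(Ū₀ʲ(Γ_r)) v_j(L•z + r)`, `Γ_r = treeWord r` (`disp Γ_r = r`). [cite: Balaban1985Averaging, (97) p.32, (85) p.31, (82) p.30] -/
theorem coe_vcov_succ_eq (L : ℕ) (U₀ U₁ : Site d → Fin d → 𝔸ˣ) (j : ℕ) (z : Site d) :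
    ((vcov L U₀ U₁ (j + 1) z : 𝔸ˣ) : 𝔸)
      = (vcov L U₀ U₁ j ((L : ℤ) • z) : 𝔸)
        * eml (fun r : Fin d → Fin L => (((vcov L U₀ U₁ j ((L : ℤ) • z))⁻¹ : 𝔸ˣ) : 𝔸)
          * (((tHol (avgIter L U₀ j) (tildIter L U₀ U₁ j) ((L : ℤ) • z) (treeWord (boxVec L r)) : 𝔸ˣ) : 𝔸)
            * ((Rc (hol (avgIter L U₀ j) ((L : ℤ) • z) (treeWord (boxVec L r))) (vcov L U₀ U₁ j ((L : ℤ) • z + boxVec L r)) : 𝔸ˣ) : 𝔸))) := by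
  rw [vcov_succ, Units.val_mul, coe_wframe_eq_eml]
  congr 1
  congr 1
  funext r
  rw [tHol_dbavgCovIter_eq_frame_inv_mul, disp_treeWord, Units.val_mul, Units.val_mul]

/-! ## §2 ★★ The one-step comb accumulated-frame inequality -/

/-- ★★ **THE ONE-STEP COMB ACCUMULATED-FRAME INEQUALITY, POINTWISE**: with `v_j = vcov L U₀ U₁ j`, if `‖v_j(L•z)‖ ≤ 1`, the rotated end frames have norm `≤ 1`, and every twisted tree
transport `(R_{0,L•z}U̿₁ʲ)(Γ_r)` is within `t ≤ ¼` of `1`, then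
`‖v_{j+1}(z) − 1‖ ≤ (Lᵈ)⁻¹·Σ_r (‖(R_{0,L•z}Ũ₁ʲ)(Γ_r) − 1‖ + ‖R(Ū₀ʲ(Γ_r))v_j(L•z + r) − 1‖) + 6t²` — the centre frame `v_j(L•z)` does not enter at first order (✓px22's abstract row, by name).
[cite: Balaban1985Averaging, (82) p.30, (97) p.32, (26)-(27) p.22; Balaban1987RG1, (0.4) p.253] -/
theorem norm_vcov_succ_sub_one_le {L : ℕ} (hL : 0 < L) (U₀ U₁ : Site d → Fin d → 𝔸ˣ) (j : ℕ) (z : Site d) {t : ℝ}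
    (hv : ‖(vcov L U₀ U₁ j ((L : ℤ) • z) : 𝔸)‖ ≤ 1)
    (ha : ∀ r : Fin d → Fin L, ‖((Rc (hol (avgIter L U₀ j) ((L : ℤ) • z) (treeWord (boxVec L r))) (vcov L U₀ U₁ j ((L : ℤ) • z + boxVec L r)) : 𝔸ˣ) : 𝔸)‖ ≤ 1)
    (ht : ∀ r : Fin d → Fin L, ‖((tHol (avgIter L U₀ j) (dbavgCovIter L U₀ U₁ j) ((L : ℤ) • z) (treeWord (boxVec L r)) : 𝔸ˣ) : 𝔸) - 1‖ ≤ t) (ht4 : t ≤ 1 / 4) :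
    ‖(vcov L U₀ U₁ (j + 1) z : 𝔸) - 1‖
      ≤ (Fintype.card (Fin d → Fin L) : ℝ)⁻¹ * ∑ r : Fin d → Fin L,
          (‖((tHol (avgIter L U₀ j) (tildIter L U₀ U₁ j) ((L : ℤ) • z) (treeWord (boxVec L r)) : 𝔸ˣ) : 𝔸) - 1‖
            + ‖((Rc (hol (avgIter L U₀ j) ((L : ℤ) • z) (treeWord (boxVec L r))) (vcov L U₀ U₁ j ((L : ℤ) • z + boxVec L r)) : 𝔸ˣ) : 𝔸) - 1‖)
        + 6 * t ^ 2 := by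
  haveI : Nonempty (Fin d → Fin L) := ⟨fun _ => ⟨0, hL⟩⟩
  have ht' : ∀ r : Fin d → Fin L, ‖(((vcov L U₀ U₁ j ((L : ℤ) • z))⁻¹ : 𝔸ˣ) : 𝔸)
        * ((((tHol (avgIter L U₀ j) (tildIter L U₀ U₁ j) ((L : ℤ) • z) (treeWord (boxVec L r)) : 𝔸ˣ) : 𝔸)
          * ((Rc (hol (avgIter L U₀ j) ((L : ℤ) • z) (treeWord (boxVec L r))) (vcov L U₀ U₁ j ((L : ℤ) • z + boxVec L r)) : 𝔸ˣ) : 𝔸))) - 1‖ ≤ t := by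
    intro r
    have h := ht r
    rwa [tHol_dbavgCovIter_eq_frame_inv_mul, disp_treeWord, Units.val_mul, Units.val_mul] at h
  rw [coe_vcov_succ_eq]
  exact norm_mul_eml_sub_one_le_split (vcov L U₀ U₁ j ((L : ℤ) • z)) hv _ _ ha ht' ht4

/-- ★★ **THE SAME WITH THE END FRAMES' ROWS DISCHARGED FROM BI-CONTRACTIVITY**: if the background tree transports `Ū₀ʲ(Γ_r)` and their inverses have norm `≤ 1` and the frames
`v_j` are bi-contractive on the box (`‖v‖, ‖v⁻¹‖ ≤ 1` — unitarity), then `‖a_r‖ ≤ 1` and `‖a_r − 1‖ ≤ ‖v_j(L•z + r) − 1‖`, so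
`‖v_{j+1}(z) − 1‖ ≤ (Lᵈ)⁻¹·Σ_r (‖(R_{0,L•z}Ũ₁ʲ)(Γ_r) − 1‖ + ‖v_j(L•z + r) − 1‖) + 6t²` — the block MEAN of the old frame deviations plus the single-bar tree-ratio deviations.
[cite: Balaban1985Averaging, (82) p.30, (85) p.31, (97) p.32, (26)-(27) p.22] -/
theorem norm_vcov_succ_sub_one_le_of_bicontractive {L : ℕ} (hL : 0 < L) (U₀ U₁ : Site d → Fin d → 𝔸ˣ) (j : ℕ) (z : Site d) {t : ℝ}
    (hhol : ∀ r : Fin d → Fin L, ‖((hol (avgIter L U₀ j) ((L : ℤ) • z) (treeWord (boxVec L r)) : 𝔸ˣ) : 𝔸)‖ ≤ 1 ∧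
      ‖(((hol (avgIter L U₀ j) ((L : ℤ) • z) (treeWord (boxVec L r)))⁻¹ : 𝔸ˣ) : 𝔸)‖ ≤ 1)
    (hv : ‖(vcov L U₀ U₁ j ((L : ℤ) • z) : 𝔸)‖ ≤ 1)
    (hv' : ∀ r : Fin d → Fin L, ‖(vcov L U₀ U₁ j ((L : ℤ) • z + boxVec L r) : 𝔸)‖ ≤ 1)
    (ht : ∀ r : Fin d → Fin L, ‖((tHol (avgIter L U₀ j) (dbavgCovIter L U₀ U₁ j) ((L : ℤ) • z) (treeWord (boxVec L r)) : 𝔸ˣ) : 𝔸) - 1‖ ≤ t) (ht4 : t ≤ 1 / 4) :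
    ‖(vcov L U₀ U₁ (j + 1) z : 𝔸) - 1‖
      ≤ (Fintype.card (Fin d → Fin L) : ℝ)⁻¹ * ∑ r : Fin d → Fin L,
          (‖((tHol (avgIter L U₀ j) (tildIter L U₀ U₁ j) ((L : ℤ) • z) (treeWord (boxVec L r)) : 𝔸ˣ) : 𝔸) - 1‖
            + ‖(vcov L U₀ U₁ j ((L : ℤ) • z + boxVec L r) : 𝔸) - 1‖)
        + 6 * t ^ 2 := by
  have ha : ∀ r : Fin d → Fin L, ‖((Rc (hol (avgIter L U₀ j) ((L : ℤ) • z) (treeWord (boxVec L r))) (vcov L U₀ U₁ j ((L : ℤ) • z + boxVec L r)) : 𝔸ˣ) : 𝔸)‖ ≤ 1 := by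
    intro r
    rw [Rc_apply]
    exact norm_conj_le_one _ _ (hhol r).1 (hhol r).2 (hv' r)
  refine (norm_vcov_succ_sub_one_le hL U₀ U₁ j z hv ha ht ht4).trans (add_le_add ?_ le_rfl)
  refine mul_le_mul_of_nonneg_left (Finset.sum_le_sum fun r _ => add_le_add le_rfl ?_) (by positivity)
  rw [Rc_apply]
  exact norm_conj_sub_one_le _ _ (hhol r).1 (hhol r).2

end Summit.QuantumFields.YangMills.Theorems.Prop7CombAccFrameStep

end
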